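import Summits.CriticalPhenomena.CardyFormulaZ2.Theorems.CardySusyWardParafermionFamiliesToSLESixDefs

/-!
# The `conj(ẑ)`-weighted discrete Green identity (stub `stub_weightedGreen`, crux stmt-CriticalPhenomena-10814)

Helper file for the crux `CardySusyWard.ParafermionFamiliesToSLESix` (stmt-CriticalPhenomena-10814), line
`strip-anchored-vertex-normalisation` (skeleton r4), registered sub-goal `stub_weightedGreen` of
`stub_momentIdentity`: the pure-algebra telescoping step of the boundary first-moment identity.

For a finite set `S` of medial vertices `p = (x, i)` of `ℤ²` (the lattice edge `s(x, x + eᵢ)`, medial point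
`ẑ_p = x + ½eᵢ` at mesh `1`) and any corner function `F`, summing `conj(ẑ_p) · halfCRForm i p F` over `S`
(`halfCRForm i p F = Σ_k coeff i k · F(corner_k p)`, `coeff i = (1, -i, -1, i)` on `NW, NE, SE, SW`,
barrier file `FKParafermionicHalfCauchyRiemann`) gives

`Σ_{p ∈ S} conj(ẑ_p) · halfCRForm i p F = ((1 + i)/4) · Σ_{(p,k) internal} F(corner_k p)
    + Σ_{(p,k) wall} conj(ẑ_p) · coeff i k · F(corner_k p)`,

where `(p, k)` is INTERNAL if the twin medial vertex `twin p k` across the `k`-th corner is in `S` and WALL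
otherwise.  Proof: every internal corner is counted twice, as the `k`-th corner of `p` and as the antipodal
`(k+2)`-th corner of `twin p k` (`medialCornersAt_twin`, `twin_twin`), with opposite coefficients
(`coeff_add_two`); the NEW ingredient is the geometric identity
`conj(ẑ_p) · coeff i k + conj(ẑ_{twin p k}) · coeff i (k+2) = coeff i k · conj(ẑ_p − ẑ_{twin p k}) = (1 + i)/2`
for EVERY `k` (`weight_pair`; the twin offsets `ẑ_{twin} − ẑ_p` are `(−1+i)/2, (1+i)/2, (1−i)/2, (−1−i)/2`
for `k = 0, 1, 2, 3`, `medialPoint_twin_sub`): the half-CR form is a discrete `∂̄` and `∂̄ z̄ = 1`.  Reindexing the finite set of internal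
pairs along the involution `(p, k) ↦ (twin p k, k + 2)` (`Finset.sum_nbij'`) and adding the two copies gives
`2 · (internal sum) = ((1 + i)/2) · Σ_{internal} F`.  No probability is involved. [folklore]
-/

noncomputable section

namespace Summit.CriticalPhenomena.CardyFormulaZ2.Theorems.ParafermionFamiliesToSLESix.StripAnchored

open scoped BigOperators
open Literature.Probability.LatticeModels (DiscreteDobrushin MedialVertex Site medialPoint IsCorner zdGraph
  discreteDomainGraph)
open Literature.Barriers.CriticalPhenomena (medialCornersAt medialVertexOf HalfCRRelationAt halfCRForm)
open Literature.Barriers.CriticalPhenomena.HalfCRGreen (coeff twin coeff_add_two halfCRForm_eq_sum twin_twin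
  medialCornersAt_twin)
open Summit.CriticalPhenomena.CardyFormulaZ2.Cruxes.EdgePrecompact.QkzStripBoundaryArm (cornerObs)

namespace WeightedGreen

/-- **Twin offsets.** The medial point of the twin of `(x, i)` across its `k`-th corner minus the medial
point of `(x, i)` (mesh `1`) is `(−1+i)/2, (1+i)/2, (1−i)/2, (−1−i)/2` for `k = NW, NE, SE, SW`, for both
directions `i`. [folklore] -/
theorem medialPoint_twin_sub (x : Site 2) (i : Fin 2) (k : Fin 4) :
    medialPoint 1 (medialVertexOf (twin x i k)) - medialPoint 1 (medialVertexOf (x, i)) =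
      ![(-1 + Complex.I) / 2, (1 + Complex.I) / 2, (1 - Complex.I) / 2, (-1 - Complex.I) / 2] k := by
  fin_cases i <;> fin_cases k <;>
    simp [twin, medialVertexOf, Literature.Probability.LatticeModels.meshPoint] <;>
    apply Complex.ext <;> simp [Literature.Probability.LatticeModels.Site.toComplex] <;> ring

/-- **The pair weight is constant.** For every medial vertex `(x, i)` and every corner index `k`,
`conj(ẑ_{(x,i)}) · coeff i k + conj(ẑ_{twin x i k}) · coeff i (k + 2) = (1 + i)/2`: the two contributions
of an internal corner to the `conj(ẑ)`-weighted sum of half-CR forms add up to `(1 + i)/2` times the corner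
value (`coeff i (k+2) = -coeff i k` and `coeff i k · conj(ẑ_p − ẑ_twin) = (1 + i)/2`). [folklore] -/
theorem weight_pair (x : Site 2) (i : Fin 2) (k : Fin 4) :
    (starRingEnd ℂ) (medialPoint 1 (medialVertexOf (x, i))) * coeff Complex.I k +
      (starRingEnd ℂ) (medialPoint 1 (medialVertexOf (twin x i k))) * coeff Complex.I (k + 2) =
      (1 + Complex.I) / 2 := by
  rw [coeff_add_two]
  fin_cases i <;> fin_cases k <;> apply Complex.ext <;>
    simp only [Complex.add_re, Complex.add_im, Complex.mul_re, Complex.mul_im, Complex.neg_re,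
      Complex.neg_im, Complex.conj_re, Complex.conj_im] <;>
    simp [twin, medialVertexOf, Literature.Probability.LatticeModels.meshPoint,
      Literature.Probability.LatticeModels.Site.toComplex, coeff] <;> ring

/-- **The weighted Green identity** (statement with the weight `w p := conj(ẑ_p)` written out): summing
`conj(ẑ_p) · halfCRForm i p F` over a finite set `S` of medial vertices telescopes the internal corners into
`((1 + i)/4) · Σ_{internal} F` and leaves the weighted wall terms. [folklore] -/
theorem sum_conj_medialPoint_mul_halfCRForm (S : Finset (Site 2 × Fin 2)) (F : Site 2 × Site 2 → ℂ) :
    ∑ p ∈ S, (starRingEnd ℂ) (medialPoint 1 (medialVertexOf p)) * halfCRForm Complex.I p F =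
      (1 + Complex.I) / 4 *
          ∑ p ∈ S, ∑ k : Fin 4, (if twin p.1 p.2 k ∈ S then F (medialCornersAt p.1 p.2 k) else 0) +
        ∑ p ∈ S, ∑ k : Fin 4, (if twin p.1 p.2 k ∈ S then 0 else
          (starRingEnd ℂ) (medialPoint 1 (medialVertexOf p)) * coeff Complex.I k *
            F (medialCornersAt p.1 p.2 k)) := by
  -- split every weighted vertex form into its internal and its wall corners
  have hsplit : ∀ p ∈ S, (starRingEnd ℂ) (medialPoint 1 (medialVertexOf p)) * halfCRForm Complex.I p F =
      (∑ k : Fin 4, if twin p.1 p.2 k ∈ S then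
          (starRingEnd ℂ) (medialPoint 1 (medialVertexOf p)) * coeff Complex.I k *
            F (medialCornersAt p.1 p.2 k) else 0) +
        ∑ k : Fin 4, (if twin p.1 p.2 k ∈ S then 0 else
          (starRingEnd ℂ) (medialPoint 1 (medialVertexOf p)) * coeff Complex.I k *
            F (medialCornersAt p.1 p.2 k)) := by
    intro p _
    rw [halfCRForm_eq_sum, Finset.mul_sum, ← Finset.sum_add_distrib]
    refine Finset.sum_congr rfl fun k _ => ?_
    split_ifs <;> simp [mul_assoc]
  rw [Finset.sum_congr rfl hsplit, Finset.sum_add_distrib]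
  congr 1
  -- the internal pairs `(p, k)`, `p ∈ S`, `twin p k ∈ S`, as a finite set
  set T : Finset ((Site 2 × Fin 2) × Fin 4) :=
    (S ×ˢ (Finset.univ : Finset (Fin 4))).filter (fun a => twin a.1.1 a.1.2 a.2 ∈ S) with hT
  have hint : ∑ p ∈ S, ∑ k : Fin 4, (if twin p.1 p.2 k ∈ S then
      (starRingEnd ℂ) (medialPoint 1 (medialVertexOf p)) * coeff Complex.I k *
        F (medialCornersAt p.1 p.2 k) else 0) =
      ∑ a ∈ T, (starRingEnd ℂ) (medialPoint 1 (medialVertexOf a.1)) * coeff Complex.I a.2 *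
        F (medialCornersAt a.1.1 a.1.2 a.2) := by
    rw [hT, Finset.sum_filter, Finset.sum_product]
  have hplain : ∑ p ∈ S, ∑ k : Fin 4, (if twin p.1 p.2 k ∈ S then F (medialCornersAt p.1 p.2 k) else 0) =
      ∑ a ∈ T, F (medialCornersAt a.1.1 a.1.2 a.2) := by
    rw [hT, Finset.sum_filter, Finset.sum_product]
  -- `T` is stable under the twin involution `(p, k) ↦ (twin p k, k + 2)`
  have hmemT : ∀ a ∈ T, (twin a.1.1 a.1.2 a.2, a.2 + 2) ∈ T := by
    rintro ⟨⟨x, i⟩, k⟩ ha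
    simp only [hT, Finset.mem_filter, Finset.mem_product, Finset.mem_univ, and_true] at ha ⊢
    rw [twin_twin]
    exact ⟨ha.2, ha.1⟩
  have hinv : ∀ a ∈ T,
      (twin (twin a.1.1 a.1.2 a.2).1 (twin a.1.1 a.1.2 a.2).2 (a.2 + 2), a.2 + 2 + 2) = a := by
    rintro ⟨⟨x, i⟩, k⟩ _
    refine Prod.ext (twin_twin x i k) ?_
    show k + 2 + 2 = k
    fin_cases k <;> rfl
  -- reindex the internal sum along the involution: the same corner, seen from the twin
  have hreindex : ∑ a ∈ T, (starRingEnd ℂ) (medialPoint 1 (medialVertexOf a.1)) * coeff Complex.I a.2 *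
        F (medialCornersAt a.1.1 a.1.2 a.2) =
      ∑ a ∈ T, (starRingEnd ℂ) (medialPoint 1 (medialVertexOf (twin a.1.1 a.1.2 a.2))) *
        coeff Complex.I (a.2 + 2) * F (medialCornersAt a.1.1 a.1.2 a.2) := by
    refine Finset.sum_nbij' (fun a => (twin a.1.1 a.1.2 a.2, a.2 + 2))
      (fun a => (twin a.1.1 a.1.2 a.2, a.2 + 2)) hmemT hmemT hinv hinv ?_
    rintro ⟨⟨x, i⟩, k⟩ _
    simp only [twin_twin, medialCornersAt_twin]
    congr 2
    show coeff Complex.I k = coeff Complex.I (k + 2 + 2)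
    congr 1
    fin_cases k <;> rfl
  -- add the two expressions of the internal sum: every internal corner weighs `(1 + i)/2`
  have htwo : 2 * ∑ a ∈ T, (starRingEnd ℂ) (medialPoint 1 (medialVertexOf a.1)) * coeff Complex.I a.2 *
        F (medialCornersAt a.1.1 a.1.2 a.2) =
      (1 + Complex.I) / 2 * ∑ a ∈ T, F (medialCornersAt a.1.1 a.1.2 a.2) := by
    rw [two_mul]
    nth_rewrite 2 [hreindex]
    rw [← Finset.sum_add_distrib, Finset.mul_sum]
    refine Finset.sum_congr rfl ?_
    rintro ⟨⟨x, i⟩, k⟩ _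
    linear_combination F (medialCornersAt x i k) * weight_pair x i k
  rw [hint, hplain]
  linear_combination htwo / 2

end WeightedGreen

/-- **Registered sub-goal `stub_weightedGreen`** (of the skeleton stub `stub_momentIdentity`, line
`strip-anchored-vertex-normalisation` r4 of stmt-CriticalPhenomena-10814): the `conj(ẑ)`-weighted discrete
Green identity for the half-CR vertex form with coefficient `i` — over any finite set `S` of medial vertices
and for any corner function `F`, `Σ_{p ∈ S} conj(ẑ_p) · halfCRForm i p F = ((1 + i)/4) · Σ_{internal (p,k)} F
+ Σ_{wall (p,k)} conj(ẑ_p) · coeff i k · F` (`ẑ_p = medialPoint 1 (medialVertexOf p)`; internal / wall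
according as the twin medial vertex across the corner is in `S` or not). [folklore] -/
theorem stub_weightedGreen : ∀ (S : Finset (Site 2 × Fin 2)) (F : Site 2 × Site 2 → ℂ), ∑ p ∈ S, (starRingEnd ℂ) (medialPoint 1 (medialVertexOf p)) * halfCRForm Complex.I p F = (1 + Complex.I) / 4 * ∑ p ∈ S, ∑ k : Fin 4, (if twin p.1 p.2 k ∈ S then F (medialCornersAt p.1 p.2 k) else 0) + ∑ p ∈ S, ∑ k : Fin 4, (if twin p.1 p.2 k ∈ S then 0 else (starRingEnd ℂ) (medialPoint 1 (medialVertexOf p)) * coeff Complex.I k * F (medialCornersAt p.1 p.2 k)) :=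
  WeightedGreen.sum_conj_medialPoint_mul_halfCRForm

end Summit.CriticalPhenomena.CardyFormulaZ2.Theorems.ParafermionFamiliesToSLESix.StripAnchored

end
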